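import Summits.AtomisticToContinuum.Crystallization.Theorems.ReggeStarCoercivityDefectFreeCrystallizesHullCriterion

/-!
# Crux `TransitiveLocalLimit` (stmt-AtomisticToContinuum-15100), line `MotifTwo` — stub `stub_extract`

STUB 5 of the skeleton `Cruxes/TransitiveLocalLimit/Lines/MotifTwo.lean` (diagonal extraction; pure
filter bookkeeping): a set `S ⊆ ℝ³` that is two-way `ε`-matched on every ball `‖·‖ ≤ R` by translates
of `x N`, FREQUENTLY in `N`, is a local limit along a subsequence: some `StrictMono σ` and
translations `τ j` give two-way `ε`-matching on `‖·‖ ≤ R` EVENTUALLY in `j`, for every `R` and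
every `ε > 0`.

Proof. For each `j : ℕ` apply the hypothesis at the scale `(R, ε) = (j+1, 1/(j+1))`;
`Filter.extraction_forall_of_frequently` extracts a strictly increasing `σ` with a matching
translation at `N = σ j` for every `j`, and `choose` gives the translations `τ j`. For a fixed scale
`(R, ε)` with `ε > 0`, eventually in `j` one has `R ≤ j+1` and `1/(j+1) ≤ ε`
(`PrestressSplitKorn.hull_eventually_scale`), and two-way matching is monotone in the scale
(`PrestressSplitKorn.hull_match_mono`). This is steps (1) and (3) of
`PrestressSplitKorn.stub_hullCriterion` with a general set `S` in place of `P.points`.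
-/

noncomputable section

namespace Summit.AtomisticToContinuum.Crystallization.Theorems.TransitiveLocalLimitMotifTwo

open Filter
open Literature.MathematicalPhysics.StatisticalMechanics

/-- **STUB 5 — DIAGONAL EXTRACTION**: a set matched two-way on every ball by translates of `x N`,
frequently in `N`, is a local limit along a subsequence: some `StrictMono σ` and translations `τ j`
give two-way `ε`-matching on `‖·‖ ≤ R` EVENTUALLY in `j`, for every `R` and `ε > 0`. Extraction
along the scales `(j+1, 1/(j+1))` with `Filter.extraction_forall_of_frequently`, `choose` for the
translations, then `PrestressSplitKorn.hull_eventually_scale` and `PrestressSplitKorn.hull_match_mono`. -/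
theorem stub_extract : ∀ (x : (N : ℕ) → (Fin N → EuclideanSpace ℝ (Fin 3))) (S : Set (EuclideanSpace ℝ (Fin 3))), (∀ R ε : ℝ, 0 < ε → ∃ᶠ N in atTop, ∃ t : EuclideanSpace ℝ (Fin 3), (∀ p ∈ S, ‖p‖ ≤ R → ∃ i : Fin N, dist (x N i + t) p ≤ ε) ∧ (∀ i : Fin N, ‖x N i + t‖ ≤ R → ∃ p ∈ S, dist (x N i + t) p ≤ ε)) → ∃ (σ : ℕ → ℕ) (τ : ℕ → EuclideanSpace ℝ (Fin 3)), StrictMono σ ∧ ∀ R ε : ℝ, 0 < ε → ∀ᶠ j : ℕ in atTop, (∀ p ∈ S, ‖p‖ ≤ R → ∃ i : Fin (σ j), dist (x (σ j) i + τ j) p ≤ ε) ∧ (∀ i : Fin (σ j), ‖x (σ j) i + τ j‖ ≤ R → ∃ p ∈ S, dist (x (σ j) i + τ j) p ≤ ε) := by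
  intro x S hS
  -- (1) diagonal extraction over the scales `(j+1, 1/(j+1))`
  have hfreq : ∀ j : ℕ, ∃ᶠ N in atTop, ∃ t : EuclideanSpace ℝ (Fin 3),
      (∀ p ∈ S, ‖p‖ ≤ (j : ℝ) + 1 → ∃ i : Fin N, dist (x N i + t) p ≤ 1 / ((j : ℝ) + 1)) ∧
      (∀ i : Fin N, ‖x N i + t‖ ≤ (j : ℝ) + 1 →
        ∃ p ∈ S, dist (x N i + t) p ≤ 1 / ((j : ℝ) + 1)) :=
    fun j => hS ((j : ℝ) + 1) (1 / ((j : ℝ) + 1)) (by positivity)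
  obtain ⟨σ, hσ, hσQ⟩ := Filter.extraction_forall_of_frequently hfreq
  choose τ hτ using hσQ
  -- (2) eventual matching at every fixed scale
  refine ⟨σ, τ, hσ, fun R ε hε => ?_⟩
  filter_upwards [PrestressSplitKorn.hull_eventually_scale R ε hε] with j hj
  exact PrestressSplitKorn.hull_match_mono (y := fun i => x (σ j) i + τ j) hj.1 hj.2 (hτ j)

end Summit.AtomisticToContinuum.Crystallization.Theorems.TransitiveLocalLimitMotifTwo

end
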